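import Summits.AtomisticToContinuum.BoseEinsteinCondensation.Theorems.BECGroundStateSOSPeriodicIRBoundPFOpNorm
import Summits.AtomisticToContinuum.BoseEinsteinCondensation.Theorems.BECGroundStateSOSPeriodicIRBoundPFJensen
import Summits.AtomisticToContinuum.BoseEinsteinCondensation.Theorems.BECGroundStateSOSPeriodicIRBoundPFPositive
import HarnessLib

/-!
# Crux `PeriodicIRBound` (stmt-AtomisticToContinuum-3972), line `linear-ph-floor-wagner`, stub S-B
# `stub_fkPositiveOfMinimiser` — part 4: the Feynman–Kac eigen-equation of a maximal-form minimiser and the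
# registered stub (nonnegative minimisers are a.e. strictly positive)

Helper file of the line lead (seat c2), sequel of `…PFOpNorm.lean`, `…PFJensen.lean`, `…PFPositive.lean`; it
closes the registered stub S-B of the crux skeleton `Cruxes/PeriodicIRBound/Lines/linear_ph_floor_wagner.lean`
(v11). KEY: for `N ≥ 1`, `L > 0`, a finite-range INTEGRABLE (possibly unbounded) profile `v`, every
`L²(cell)`-normalised nonnegative measurable periodic `f` that is the `L²(cell)`-limit of real periodic `C¹`
functions `φ` with `∫|∇φ|² + ∫Vφ² ≤ E₀(v) + ε` is a.e. STRICTLY POSITIVE on the cell — given the small-time form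
upper bound of stub S-A (hypothesis, verbatim). Proof (Reed–Simon IV Thm XIII.44 without operator theory for
the unbounded `H_v`): with `T = e^{-H_v}` (`pfkL2 v L 1`) and `c = e^{-E₀(v)}`,
(i) `‖T‖ ≤ c` (`opNorm_pfkL2_le_exp`, part 1); (ii) Jensen `⟪T[f], [f]⟫ ≥ c` (`inner_pfkL2_toLp_ge_exp_of_approx`:
part 2 on the approximants, `L²`-continuity of the pairing); (iii) hence `‖T[f] - c[f]‖² ≤ c² - 2c² + c² = 0`,
the Feynman–Kac EIGEN-EQUATION `E_X[e^{-A_1} f(B_1)] = c·f(X)` for a.e. `X ∈ cell`; (iv) the left side is a.e.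
strictly positive (part 3: a.s. finite action, positive Gaussian density), so `f > 0` a.e.

References: Reed–Simon IV §XIII.12 Thms XIII.43–XIII.44; Faris–Simon, Duke Math. J. 42 (1975) 559; Chung–Zhao
(1995) §3.2.
-/

noncomputable section

open scoped BigOperators ENNReal NNReal InnerProductSpace Topology
open Filter MeasureTheory

namespace Summit.AtomisticToContinuum.BoseEinsteinCondensation.Cruxes.PeriodicIRBound.LinearPhFloorWagner

open Literature.MathematicalPhysics.QuantumManyBody
open Literature.MathematicalPhysics.QuantumManyBody.BoseGas

variable {N : ℕ}

/-! ## §1 Jensen's bound for an `L²(cell)`-limit of periodic `C¹` functions of bounded energy -/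

/-- The real cell integral of a square is the `toReal` of the `ofReal`-lintegral. [folklore] -/
theorem setIntegral_cellN_sq_eq_toReal {L : ℝ} {g : Config N → ℝ} (hg : Measurable g) :
    ∫ X in cellN N L, g X ^ 2 = (∫⁻ X in cellN N L, ENNReal.ofReal (g X ^ 2)).toReal :=
  integral_eq_lintegral_of_nonneg_ae (Eventually.of_forall fun _ => sq_nonneg _)
    ((hg.pow_const 2).aestronglyMeasurable)

/-- **Jensen's bound passes to `L²(cell)`-limits**: if the form upper bound of stub S-A holds, `E < ∞`, and the unit
vector `[f] ∈ L²(cell)` is approximated, for every `ε > 0`, by a real periodic `C¹` function `φ` with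
`∫_cell(φ - f)² ≤ ε` and `∫_cell|∇φ|² + ∫_cell Vφ² ≤ E + ε`, then `e^{-τE} ≤ ⟪e^{-τH}[f], [f]⟫` (`τ > 0`).
[cite: ReedSimonIV1978, Thm XIII.44] -/
theorem inner_pfkL2_toLp_ge_exp_of_approx
    (hFUB : ∀ {N : ℕ} {L : ℝ}, 0 < L → ∀ {v : ℝ → ℝ≥0∞}, Measurable v →
      (∫⁻ X in cellN N L, periodicInteraction v L X) ≠ ⊤ →
      ∀ {ψ : Config N → ℝ}, ContDiff ℝ 1 ψ →
        (∀ (X : Config N) (i : Fin N) (k : Fin 3), ψ (X + Pi.single i (EuclideanSpace.single k L)) = ψ X) →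
        (∫⁻ X in cellN N L, ENNReal.ofReal (ψ X ^ 2) * periodicInteraction v L X) ≠ ⊤ →
        ∀ ε : ℝ, 0 < ε → ∃ t₀ : ℝ, 0 < t₀ ∧ ∀ t : ℝ≥0, t ≠ 0 → (t : ℝ) < t₀ →
          (∫ X in cellN N L, ψ X ^ 2) - ∫ X in cellN N L, ψ X * pfkReal v L t ψ X ≤
            t * ((∫⁻ X in cellN N L, realKinetic ψ X).toReal +
              (∫⁻ X in cellN N L, ENNReal.ofReal (ψ X ^ 2) * periodicInteraction v L X).toReal + ε))
    {L : ℝ} (hL : 0 < L) {v : ℝ → ℝ≥0∞} (hv : Measurable v)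
    (hW : ∫⁻ X in cellN N L, periodicInteraction v L X ≠ ⊤) {E : ℝ≥0∞} (hE : E ≠ ⊤)
    {f : Config N → ℝ} (hfm : Measurable f) (hmem : MemLp f 2 (volume.restrict (cellN N L)))
    (hx1 : ‖hmem.toLp f‖ = 1)
    (happrox : ∀ ε : ℝ, 0 < ε → ∃ φ : Config N → ℝ, ContDiff ℝ 1 φ ∧
      (∀ (X : Config N) (i : Fin N) (k : Fin 3), φ (X + Pi.single i (EuclideanSpace.single k L)) = φ X) ∧
      (∫⁻ X in cellN N L, ENNReal.ofReal ((φ X - f X) ^ 2)) ≤ ENNReal.ofReal ε ∧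
      (∫⁻ X in cellN N L, realKinetic φ X) +
          (∫⁻ X in cellN N L, ENNReal.ofReal (φ X ^ 2) * periodicInteraction v L X) ≤ E + ENNReal.ofReal ε)
    {τ : ℝ} (hτ : 0 < τ) :
    Real.exp (-(E.toReal * τ)) ≤ ⟪pfkL2 v L τ (hmem.toLp f), hmem.toLp f⟫_ℝ := by
  set μ : Measure (Config N) := volume.restrict (cellN N L) with hμ
  set x : Lp ℝ 2 μ := hmem.toLp f with hxdef
  set T : Lp ℝ 2 μ →L[ℝ] Lp ℝ 2 μ := pfkL2 v L τ with hTdef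
  -- the approximants at accuracy `εₖ = 1/(k+1)²`
  set e : ℕ → ℝ := fun k => 1 / ((k : ℝ) + 1) ^ 2 with hedef
  have he : ∀ k, 0 < e k := fun k => by positivity
  choose φ hφ using fun k => happrox (e k) (he k)
  have hφc : ∀ k, ContDiff ℝ 1 (φ k) := fun k => (hφ k).1
  have hφper := fun k => (hφ k).2.1
  have hφdist : ∀ k, ∫⁻ X in cellN N L, ENNReal.ofReal ((φ k X - f X) ^ 2) ≤ ENNReal.ofReal (e k) :=
    fun k => (hφ k).2.2.1
  have hφE : ∀ k, (∫⁻ X in cellN N L, realKinetic (φ k) X) +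
      (∫⁻ X in cellN N L, ENNReal.ofReal (φ k X ^ 2) * periodicInteraction v L X) ≤ E + ENNReal.ofReal (e k) :=
    fun k => (hφ k).2.2.2
  have hmemk : ∀ k, MemLp (φ k) 2 μ := fun k => memLp_two_cellN_of_contDiff_periodic hL (hφc k) (hφper k)
  set xk : ℕ → Lp ℝ 2 μ := fun k => (hmemk k).toLp (φ k) with hxkdef
  -- finiteness of the two energies of the approximants
  have hfinE : ∀ k, E + ENNReal.ofReal (e k) ≠ ⊤ := fun k => ENNReal.add_ne_top.2 ⟨hE, ENNReal.ofReal_ne_top⟩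
  have hkin : ∀ k, ∫⁻ X in cellN N L, realKinetic (φ k) X ≠ ⊤ := fun k =>
    ne_top_of_le_ne_top (hfinE k) (le_trans (self_le_add_right _ _) (hφE k))
  have hpot : ∀ k, ∫⁻ X in cellN N L, ENNReal.ofReal (φ k X ^ 2) * periodicInteraction v L X ≠ ⊤ := fun k =>
    ne_top_of_le_ne_top (hfinE k) (le_trans (self_le_add_left _ _) (hφE k))
  -- the real energies `ℰₖ ≤ E.toReal + εₖ`
  set ℰ : ℕ → ℝ := fun k => (∫⁻ X in cellN N L, realKinetic (φ k) X).toReal +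
    (∫⁻ X in cellN N L, ENNReal.ofReal (φ k X ^ 2) * periodicInteraction v L X).toReal with hℰdef
  have hℰle : ∀ k, ℰ k ≤ E.toReal + e k := fun k => by
    have h := ENNReal.toReal_mono (hfinE k) (hφE k)
    rwa [ENNReal.toReal_add (hkin k) (hpot k), ENNReal.toReal_add hE ENNReal.ofReal_ne_top,
      ENNReal.toReal_ofReal (he k).le] at h
  -- `‖xₖ - x‖ ≤ 1/(k+1)`, so `xₖ → x`
  have hdist : ∀ k, ‖xk k - x‖ ≤ 1 / ((k : ℝ) + 1) := fun k => by
    have hsub : xk k - x = ((hmemk k).sub hmem).toLp (φ k - f) := by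
      rw [hxkdef, hxdef]; exact (MemLp.toLp_sub (hmemk k) hmem).symm
    have hsq : ‖xk k - x‖ ^ 2 ≤ (1 / ((k : ℝ) + 1)) ^ 2 := by
      rw [hsub, norm_toLp_sq_real ((hmemk k).sub hmem)]
      have hm : Measurable fun X => φ k X - f X := (hφc k).continuous.measurable.sub hfm
      have h1 : ∫ X in cellN N L, (φ k - f) X ^ 2 = (∫⁻ X in cellN N L, ENNReal.ofReal ((φ k X - f X) ^ 2)).toReal :=
        setIntegral_cellN_sq_eq_toReal hm
      rw [h1]
      have h2 := ENNReal.toReal_mono ENNReal.ofReal_ne_top (hφdist k)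
      rw [ENNReal.toReal_ofReal (he k).le] at h2
      calc _ ≤ e k := h2
        _ = (1 / ((k : ℝ) + 1)) ^ 2 := by rw [hedef, one_div_pow]
    have h0 : 0 ≤ 1 / ((k : ℝ) + 1) := by positivity
    exact (pow_le_pow_iff_left₀ (norm_nonneg _) h0 two_ne_zero).1 hsq
  have hxk : Tendsto xk atTop (𝓝 x) := by
    rw [tendsto_iff_norm_sub_tendsto_zero]
    exact squeeze_zero (fun k => norm_nonneg _) hdist tendsto_one_div_add_atTop_nhds_zero_nat
  -- the pairings and the norms converge
  have hpair : Tendsto (fun k => ⟪T (xk k), xk k⟫_ℝ) atTop (𝓝 ⟪T x, x⟫_ℝ) :=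
    ((T.continuous.tendsto x).comp hxk).inner hxk
  have hnorm : Tendsto (fun k => ‖xk k‖ ^ 2) atTop (𝓝 1) := by
    have h := ((continuous_norm.tendsto x).comp hxk).pow 2
    rw [hx1, one_pow] at h
    exact h
  -- the lower bounds `‖xₖ‖² e^{-τ(E'+εₖ)/‖xₖ‖²} → e^{-τE'}`
  have he0 : Tendsto e atTop (𝓝 0) := by
    have h := (tendsto_one_div_add_atTop_nhds_zero_nat :
      Tendsto (fun n : ℕ => 1 / ((n : ℝ) + 1)) atTop (𝓝 0)).pow 2
    rw [zero_pow two_ne_zero] at h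
    refine h.congr fun k => ?_
    rw [hedef, one_div_pow]
  have hh : Tendsto (fun k => ‖xk k‖ ^ 2 * Real.exp (-(τ * (E.toReal + e k) / ‖xk k‖ ^ 2))) atTop
      (𝓝 (Real.exp (-(E.toReal * τ)))) := by
    have h1 : Tendsto (fun k => -(τ * (E.toReal + e k) / ‖xk k‖ ^ 2)) atTop (𝓝 (-(E.toReal * τ))) := by
      have h1' := ((((tendsto_const_nhds (x := E.toReal)).add he0).const_mul τ).div hnorm one_ne_zero).neg
      have heq : -(τ * (E.toReal + 0) / 1) = -(E.toReal * τ) := by ring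
      rw [heq] at h1'
      exact h1'
    have h2 := hnorm.mul ((Real.continuous_exp.tendsto _).comp h1)
    rw [one_mul] at h2
    exact h2
  -- eventually the Jensen bound of part 2 applies to `xₖ`
  have hev : ∀ᶠ k in atTop,
      ‖xk k‖ ^ 2 * Real.exp (-(τ * (E.toReal + e k) / ‖xk k‖ ^ 2)) ≤ ⟪T (xk k), xk k⟫_ℝ := by
    filter_upwards [hnorm.eventually (lt_mem_nhds one_pos)] with k hk
    have hB := setIntegral_mul_pfkReal_ge_exp_of_formUpperBound hFUB hL hv hW (hφc k) (hφper k) (hpot k) hτ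
    have hn : ∫ X in cellN N L, φ k X ^ 2 = ‖xk k‖ ^ 2 := (norm_toLp_sq_real (hmemk k)).symm
    have hi : ∫ X in cellN N L, φ k X * pfkReal v L τ (φ k) X = ⟪T (xk k), xk k⟫_ℝ :=
      (inner_pfkL2_toLp_toLp hv hL hτ (hmemk k) (hmemk k) (hφper k)).symm
    rw [hn, hi, show (∫⁻ X in cellN N L, realKinetic (φ k) X).toReal +
      (∫⁻ X in cellN N L, ENNReal.ofReal (φ k X ^ 2) * periodicInteraction v L X).toReal = ℰ k from rfl] at hB
    refine le_trans ?_ hB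
    refine mul_le_mul_of_nonneg_left (Real.exp_le_exp.2 ?_) (sq_nonneg _)
    rw [neg_le_neg_iff]
    refine div_le_div_of_nonneg_right ?_ hk.le
    exact mul_le_mul_of_nonneg_left (hℰle k) hτ.le
  exact le_of_tendsto_of_tendsto hh hpair hev

/-! ## §2 The registered stub -/

/-- **Registered stub `stub_fkPositiveOfMinimiser` of the crux skeleton (S-B, line `linear-ph-floor-wagner`, v11)**:
the form upper bound of stub S-A implies that, for `N ≥ 1`, `L > 0` and a finite-range integrable `v`, every
`L²(cell)`-normalised nonnegative measurable periodic function approximated in `L²(cell)` by real periodic `C¹`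
functions of energy `→ ≤ E₀(v)` is a.e. strictly positive on the cell (Feynman–Kac eigen-equation
`E_X[e^{-A_1}f(B_1)] = e^{-E₀}f(X)` a.e. from `‖e^{-H}‖ ≤ e^{-E₀}` and Jensen, then positivity of the left side).
[cite: ReedSimonIV1978, §XIII.12 Thm XIII.44] -/
theorem stub_fkPositiveOfMinimiser :
    (∀ {N : ℕ} {L : ℝ}, 0 < L → ∀ {v : ℝ → ℝ≥0∞}, Measurable v →
      (∫⁻ X in cellN N L, periodicInteraction v L X) ≠ ⊤ →
      ∀ {ψ : Config N → ℝ}, ContDiff ℝ 1 ψ →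
        (∀ (X : Config N) (i : Fin N) (k : Fin 3), ψ (X + Pi.single i (EuclideanSpace.single k L)) = ψ X) →
        (∫⁻ X in cellN N L, ENNReal.ofReal (ψ X ^ 2) * periodicInteraction v L X) ≠ ⊤ →
        ∀ ε : ℝ, 0 < ε → ∃ t₀ : ℝ, 0 < t₀ ∧ ∀ t : ℝ≥0, t ≠ 0 → (t : ℝ) < t₀ →
          (∫ X in cellN N L, ψ X ^ 2) - ∫ X in cellN N L, ψ X * pfkReal v L t ψ X ≤
            t * ((∫⁻ X in cellN N L, realKinetic ψ X).toReal +
              (∫⁻ X in cellN N L, ENNReal.ofReal (ψ X ^ 2) * periodicInteraction v L X).toReal + ε)) →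
    ∀ {N : ℕ}, 1 ≤ N → ∀ {L : ℝ}, 0 < L → ∀ {v : ℝ → ℝ≥0∞}, IsRepulsiveFiniteRange v → (∫⁻ x : Space, v ‖x‖) ≠ ⊤ →
      ∀ f : Config N → ℝ, Measurable f → (∀ X, 0 ≤ f X) →
        (∀ (X : Config N) (i : Fin N) (k : Fin 3), f (X + Pi.single i (EuclideanSpace.single k L)) = f X) →
        (∫⁻ X in cellN N L, ENNReal.ofReal (f X ^ 2)) = 1 →
        (∀ ε : ℝ, 0 < ε → ∃ φ : Config N → ℝ, ContDiff ℝ 1 φ ∧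
          (∀ (X : Config N) (i : Fin N) (k : Fin 3), φ (X + Pi.single i (EuclideanSpace.single k L)) = φ X) ∧
          (∫⁻ X in cellN N L, ENNReal.ofReal ((φ X - f X) ^ 2)) ≤ ENNReal.ofReal ε ∧
          (∫⁻ X in cellN N L, realKinetic φ X) +
              (∫⁻ X in cellN N L, ENNReal.ofReal (φ X ^ 2) * periodicInteraction v L X) ≤
            periodicGroundStateEnergy v N L + ENNReal.ofReal ε) →
        ∀ᵐ X ∂(volume.restrict (cellN N L)), 0 < f X := by
  intro hFUB N hN L hL v hv hint f hfm hf0 hfper hf1 happrox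
  have hW := WF.lintegral_cellN_periodicInteraction_ne_top hL hv.1 hint N
  have hE := periodicGroundStateEnergy_ne_top_of_integrable hv.1 hN hL hW
  set μ : Measure (Config N) := volume.restrict (cellN N L) with hμ
  set c : ℝ := Real.exp (-((periodicGroundStateEnergy v N L).toReal * 1)) with hcdef
  have hc : 0 < c := Real.exp_pos _
  -- `f ∈ L²(cell)` with unit norm
  have hf2 : ∫⁻ Y in cellN N L, ‖f Y‖ₑ ^ (2 : ℝ) = 1 := by
    rw [← hf1]
    refine lintegral_congr fun Y => ?_
    rw [Real.enorm_of_nonneg (hf0 Y), ENNReal.rpow_two, ← ENNReal.ofReal_pow (hf0 Y)]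
  have hmem : MemLp f 2 μ := by
    refine ⟨hfm.aestronglyMeasurable, ?_⟩
    rw [hμ, eLpNorm_two_eq_cellN, hf2, ENNReal.one_rpow]
    exact ENNReal.one_lt_top
  set x : Lp ℝ 2 μ := hmem.toLp f with hxdef
  have hx1 : ‖x‖ = 1 := by
    rw [hxdef, Lp.norm_toLp, hμ, eLpNorm_two_eq_cellN, hf2, ENNReal.one_rpow, ENNReal.toReal_one]
  set T : Lp ℝ 2 μ →L[ℝ] Lp ℝ 2 μ := pfkL2 v L 1 with hTdef
  -- (i) the operator norm and (ii) Jensen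
  have hT : ‖T‖ ≤ c := opNorm_pfkL2_le_exp hv hint hN hL one_pos
  have hJ : c ≤ ⟪T x, x⟫_ℝ := by
    have h := inner_pfkL2_toLp_ge_exp_of_approx hFUB hL hv.1 hW hE hfm hmem hx1 happrox one_pos
    rwa [← hcdef] at h
  -- (iii) the eigen-equation `T x = c • x`
  have heq : T x = c • x := by
    have hTx : ‖T x‖ ≤ c := (T.le_opNorm x).trans (by rw [hx1, mul_one]; exact hT)
    have h : ‖T x - c • x‖ ^ 2 ≤ 0 := by
      rw [@norm_sub_sq_real, inner_smul_right, norm_smul, Real.norm_eq_abs, abs_of_pos hc, hx1, mul_one]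
      nlinarith [hTx, hJ, norm_nonneg (T x)]
    have h0 : ‖T x - c • x‖ = 0 := by nlinarith [norm_nonneg (T x - c • x)]
    exact sub_eq_zero.1 (norm_eq_zero.1 h0)
  -- (iii') read on the cell: `pfkReal v L 1 f X = c * f X` a.e.
  have hae1 : ∀ᵐ X ∂μ, pfkReal v L 1 f X = c * f X := by
    have h1 := pfkL2_coeFn hv.1 hL one_pos x
    have h2 : ((c • x : Lp ℝ 2 μ) : Config N → ℝ) =ᵐ[μ] c • (x : Config N → ℝ) := Lp.coeFn_smul c x
    have h3 : (x : Config N → ℝ) =ᵐ[μ] f := hmem.coeFn_toLp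
    rw [← hTdef, heq] at h1
    filter_upwards [h1, h2, h3] with X hX1 hX2 hX3
    rw [pfkReal_comp_cellProj_congr_ae v hL one_pos h3 X, comp_cellProj_eq_self hfper] at hX1
    rw [← hX1, hX2, Pi.smul_apply, smul_eq_mul, hX3]
  -- (iv) positivity of the left side a.e.
  have hne : ¬ f =ᵐ[μ] 0 := fun h0 => by
    have h : ∫⁻ X in cellN N L, ENNReal.ofReal (f X ^ 2) = 0 := by
      refine (lintegral_congr_ae ?_).trans (lintegral_zero (μ := μ))
      filter_upwards [h0] with X hX
      simp [hX]
    rw [hf1] at h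
    exact one_ne_zero h
  have hae2 : ∀ᵐ X ∂μ, 0 < pfkReal v L 1 f X := by
    filter_upwards [ae_cellN_ae_periodicPathAction_lt_top hv.1 hL hW 1] with X hX
    exact pfkReal_pos_of_ae_action_lt_top hv.1 hL one_pos hX hfm hf0 hfper
      (by rw [hf2]; exact ENNReal.one_ne_top) hne
  filter_upwards [hae1, hae2] with X h1 h2
  rw [h1] at h2
  exact pos_of_mul_pos_right h2 hc.le

end Summit.AtomisticToContinuum.BoseEinsteinCondensation.Cruxes.PeriodicIRBound.LinearPhFloorWagner

end
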